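import Summits.BirchSwinnertonDyer.BirchSwinnertonDyer.Theorems.ResidualThetaTransportAtTwoThetaLayerLambdaCongruenceAtTwoGSideStabilization
import Summits.BirchSwinnertonDyer.BirchSwinnertonDyer.Theorems.ResidualThetaTransportAtTwoThetaLayerLambdaCongruenceAtTwoReduction
import HarnessLib

/-!
# Crux `ThetaLayerLambdaCongruenceAtTwo` (stmt-BirchSwinnertonDyer-20688): Kan⁺ from `λ`-EQUALITY AT INFINITELY MANY EVEN LAYERS

Width seat bsd-wall-rtt-p3-w3 (`--supports stmt-BirchSwinnertonDyer-20688`; closes nothing). THEOREMS ONLY.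

`thetaLayerLambdaCongruenceAtTwo_of_frequently_eq`: the crux BY NAME («`λ(Θ^{S₀}_n(W)) = λ(Θ^{S₀}_n(g;Ω))` for ALL large even
`n`») follows from (IO) «for all data of the crux and every `N₀` there is an even `n ≥ N₀` at which both depleted elements are
non-zero and the two `λ`'s AGREE» — because BOTH sup-norm sequences stabilise UNCONDITIONALLY (`…WSideStabilization`: `2^ℤ`-valued;
`…GSideStabilization`: `2^{ℤ/d!}`-valued via the spectral norm) and past stabilisation both `λ`'s grow by `2ⁿ` per double step
(three-term relation at `p = 2`, `a₂ = 0`; `…TowerGrowth`, `…OneLayerCrux`). So Kan⁺ is EQUIVALENT to its «infinitely often»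
form: the difference `λ_n(W) − λ_n(g)` along even `n` is eventually constant, and the crux says the constant is `0`.
What remains research is unchanged in substance — equality at ONE (large) layer, i.e. the congruence (H♮) there — but every
asymptotic/`μ`-type clause of the line has now been discharged unconditionally.

Nothing about any curve or form is asserted; BSD is not proved by any of this.
-/

noncomputable section

-- justification: the `Summit.BirchSwinnertonDyer.BirchSwinnertonDyer.…` path repeats a component (route-file convention)
set_option linter.dupNamespace false

open scoped Classical

open Polynomial

open Literature.NumberTheory.IwasawaTheory Literature.NumberTheory.EllipticCurves
  Literature.NumberTheory.EllipticCurves.ModularForms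

namespace Summit.BirchSwinnertonDyer.BirchSwinnertonDyer.Theorems.ThetaLayerLambdaCongruenceAtTwo

/-- **Crux `ThetaLayerLambdaCongruenceAtTwo` BY NAME from `λ`-equality at infinitely many even layers.** Hypothesis (IO): for all
data of the crux and every bound `N₀` there is an even layer `n ≥ N₀` with `Θ^{S₀}_n(W) ≠ 0`, `Θ^{S₀}_n(g;Ω) ≠ 0` and
`λ(Θ^{S₀}_n(W)) = λ(Θ^{S₀}_n(g;Ω))`. PROOF: both sup-norm sequences are eventually constant along the even layers
(`wSide_supNorm_eventually_const`, `gSide_supNorm_eventually_const` — unconditional); pick `n` past both stabilisation indices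
with equality; then (L1) of `thetaLayerLambdaCongruenceAtTwo_of_stabilized_oneLayer` holds at `n`. [cite: GreenbergVatsal2000, (10) and Thm. (1.4) (shape; the input is a hypothesis)] -/
theorem thetaLayerLambdaCongruenceAtTwo_of_frequently_eq
    (h1 : ∀ (W : WeierstrassCurve ℚ) [W.IsElliptic] [W.IsGloballyMinimal], ¬ W.HasCM → W.analyticRank = 0 → Literature.NumberTheory.EllipticCurves.Rank1Residual.GoodSS W 2 → W.frobeniusTrace 2 = 0 → W.Δ < 0 → ∀ (M : ℕ) [NeZero M] (g : CuspForm (CongruenceSubgroup.Gamma0 M) 2) (ι : Literature.NumberTheory.EllipticCurves.ModularForms.coeffField g →+* PadicAlgCl 2) (Ω : ℂ), Odd M → Literature.NumberTheory.EllipticCurves.ModularForms.IsNewform0 g → Literature.NumberTheory.Automorphic.IsCMForm (Literature.NumberTheory.EllipticCurves.ModularForms.liftToGamma1 M 2 g) → Literature.NumberTheory.EllipticCurves.ModularForms.cuspCoeff g 2 = 0 → Literature.NumberTheory.EllipticCurves.IsPlusPeriod g Ω → (∀ ℓ : ℕ, ℓ.Prime → ¬ ℓ ∣ 2 * M * W.conductorNorm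 ℤ → ‖Literature.NumberTheory.EllipticCurves.embCoeff g ι ℓ - (W.frobeniusTrace ℓ : PadicAlgCl 2)‖ < 1) → ∀ [NeZero (W.conductorNorm ℤ)] (f : CuspForm (CongruenceSubgroup.Gamma0 (W.conductorNorm ℤ)) 2), Literature.NumberTheory.EllipticCurves.ModularForms.IsNewformOf W f → ∀ (S₀ : Finset (IsDedekindDomain.HeightOneSpectrum (NumberField.RingOfIntegers ℚ))), (∀ v ∈ S₀, ((2 : ℕ) : NumberField.RingOfIntegers ℚ) ∉ v.asIdeal) → (∀ v : IsDedekindDomain.HeightOneSpectrum (NumberField.RingOfIntegers ℚ), ¬ W.HasGoodReductionAt v → v ∈ S₀) → (∀ v : IsDedekindDomain.HeightOneSpectrum (NumberField.RingOfIntegers ℚ), Rat.HeightOneSpectrum.natGenerator v ∣ M → v ∈ S₀) → ∀ N₀ : ℕ, ∃ n : ℕ, N₀ ≤ n ∧ Even n ∧ (((Literature.NumberTheory.EllipticCurves.mazurTateElement f 2 n).map (algebraMap ℚ (PadicAlgCl 2)) * ∏ v ∈ S₀, ((W.localPolynomialAt v).map (Int.castRingHom (PadicAlgCl 2))).comp (Polynomial.C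 ((Rat.HeightOneSpectrum.natGenerator v : PadicAlgCl 2)⁻¹) * (Polynomial.X + 1) ^ (PadicInt.toZModPow n (-(Literature.NumberTheory.EllipticCurves.GreenbergVatsal2000.frobeniusExponent 2 (Rat.HeightOneSpectrum.natGenerator v : ℤ_[2])))).val)) %ₘ ((Polynomial.X + 1) ^ 2 ^ n - 1)) ≠ 0 ∧ (((Literature.NumberTheory.EllipticCurves.mazurTateElementK g Ω 2 n).map ι * ∏ v ∈ S₀, (1 - Polynomial.C (Literature.NumberTheory.EllipticCurves.embCoeff g ι (Rat.HeightOneSpectrum.natGenerator v)) * Polynomial.X + (if Rat.HeightOneSpectrum.natGenerator v ∣ M then 0 else Polynomial.C (Rat.HeightOneSpectrum.natGenerator v : PadicAlgCl 2)) * Polynomial.X ^ 2).comp (Polynomial.C ((Rat.HeightOneSpectrum.natGenerator v : PadicAlgCl 2)⁻¹) * (Polynomial.X + 1) ^ (PadicInt.toZModPow n (-(Literature.NumberTheory.EllipticCurves.GreenbergVatsal2000.frobeniusExponent 2 (Rat.HeightOneSpectrum.natGenerator v : ℤ_[2])))).val)) %ₘ ((Polynomial.X + 1) ^ 2 ^ n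 - 1)) ≠ 0 ∧ Literature.NumberTheory.IwasawaTheory.layerLambda (((Literature.NumberTheory.EllipticCurves.mazurTateElement f 2 n).map (algebraMap ℚ (PadicAlgCl 2)) * ∏ v ∈ S₀, ((W.localPolynomialAt v).map (Int.castRingHom (PadicAlgCl 2))).comp (Polynomial.C ((Rat.HeightOneSpectrum.natGenerator v : PadicAlgCl 2)⁻¹) * (Polynomial.X + 1) ^ (PadicInt.toZModPow n (-(Literature.NumberTheory.EllipticCurves.GreenbergVatsal2000.frobeniusExponent 2 (Rat.HeightOneSpectrum.natGenerator v : ℤ_[2])))).val)) %ₘ ((Polynomial.X + 1) ^ 2 ^ n - 1)) = Literature.NumberTheory.IwasawaTheory.layerLambda (((Literature.NumberTheory.EllipticCurves.mazurTateElementK g Ω 2 n).map ι * ∏ v ∈ S₀, (1 - Polynomial.C (Literature.NumberTheory.EllipticCurves.embCoeff g ι (Rat.HeightOneSpectrum.natGenerator v)) * Polynomial.X + (if Rat.HeightOneSpectrum.natGenerator v ∣ M then 0 else Polynomial.C (Rat.HeightOneSpectrum.natGenerator v : PadicAlgCl 2)) * Polynomial.X ^ 2).comp (Polynomial.C ((Rat.HeightOneSpectrum.natGenerator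 v : PadicAlgCl 2)⁻¹) * (Polynomial.X + 1) ^ (PadicInt.toZModPow n (-(Literature.NumberTheory.EllipticCurves.GreenbergVatsal2000.frobeniusExponent 2 (Rat.HeightOneSpectrum.natGenerator v : ℤ_[2])))).val)) %ₘ ((Polynomial.X + 1) ^ 2 ^ n - 1))) :
    Summit.BirchSwinnertonDyer.BirchSwinnertonDyer.Theses.ResidualThetaTransportAtTwo.ThetaLayerLambdaCongruenceAtTwo := by
  refine thetaLayerLambdaCongruenceAtTwo_of_stabilized_oneLayer ?_
  intro W _ _ hcm hr hss ha hΔ M _ g ι Ω hodd hnew hcmg ha2 hΩ hcong _ f hf S₀ hS2 hSW hSM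
  have h2M : ¬ 2 ∣ M := hodd.not_two_dvd_nat
  obtain ⟨KW, hKW⟩ := wSide_supNorm_eventually_const S₀ hss ha hf hS2 0
  obtain ⟨KG, hKG⟩ := gSide_supNorm_eventually_const ι Ω S₀ hnew h2M ha2 hΩ hS2 0
  obtain ⟨n, hn, ⟨i, hi⟩, hW0, hG0, hlam⟩ :=
    h1 W hcm hr hss ha hΔ M g ι Ω hodd hnew hcmg ha2 hΩ hcong f hf S₀ hS2 hSW hSM (2 * max KW KG)
  have hiW : KW ≤ i := by have := le_max_left KW KG; omega
  have hiG : KG ≤ i := by have := le_max_right KW KG; omega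
  refine ⟨n, ⟨i, hi⟩, hW0, hG0, fun k ↦ ?_, fun k ↦ ?_, hlam⟩
  · have e1 : n + 2 * k + 2 = 0 + 2 * (i + k + 1) := by omega
    have e2 : n + 2 * k = 0 + 2 * (i + k) := by omega
    have h3 := (hKW (i + k + 1) (by omega)).trans (hKW (i + k) (by omega)).symm
    change (fun m : ℕ ↦ ((((Literature.NumberTheory.EllipticCurves.mazurTateElement f 2 m).map (algebraMap ℚ (PadicAlgCl 2)) * ∏ v ∈ S₀, ((W.localPolynomialAt v).map (Int.castRingHom (PadicAlgCl 2))).comp (Polynomial.C ((Rat.HeightOneSpectrum.natGenerator v : PadicAlgCl 2)⁻¹) * (Polynomial.X + 1) ^ (PadicInt.toZModPow m (-(Literature.NumberTheory.EllipticCurves.GreenbergVatsal2000.frobeniusExponent 2 (Rat.HeightOneSpectrum.natGenerator v : ℤ_[2])))).val)) %ₘ ((Polynomial.X + 1) ^ 2 ^ m - 1))).supNorm) (n + 2 * k + 2) ≤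
      (fun m : ℕ ↦ ((((Literature.NumberTheory.EllipticCurves.mazurTateElement f 2 m).map (algebraMap ℚ (PadicAlgCl 2)) * ∏ v ∈ S₀, ((W.localPolynomialAt v).map (Int.castRingHom (PadicAlgCl 2))).comp (Polynomial.C ((Rat.HeightOneSpectrum.natGenerator v : PadicAlgCl 2)⁻¹) * (Polynomial.X + 1) ^ (PadicInt.toZModPow m (-(Literature.NumberTheory.EllipticCurves.GreenbergVatsal2000.frobeniusExponent 2 (Rat.HeightOneSpectrum.natGenerator v : ℤ_[2])))).val)) %ₘ ((Polynomial.X + 1) ^ 2 ^ m - 1))).supNorm) (n + 2 * k)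
    rw [e1, e2]
    exact h3.le
  · have e1 : n + 2 * k + 2 = 0 + 2 * (i + k + 1) := by omega
    have e2 : n + 2 * k = 0 + 2 * (i + k) := by omega
    have h3 := (hKG (i + k + 1) (by omega)).trans (hKG (i + k) (by omega)).symm
    change (fun m : ℕ ↦ ((((Literature.NumberTheory.EllipticCurves.mazurTateElementK g Ω 2 m).map ι * ∏ v ∈ S₀, (1 - Polynomial.C (Literature.NumberTheory.EllipticCurves.embCoeff g ι (Rat.HeightOneSpectrum.natGenerator v)) * Polynomial.X + (if Rat.HeightOneSpectrum.natGenerator v ∣ M then 0 else Polynomial.C (Rat.HeightOneSpectrum.natGenerator v : PadicAlgCl 2)) * Polynomial.X ^ 2).comp (Polynomial.C ((Rat.HeightOneSpectrum.natGenerator v : PadicAlgCl 2)⁻¹) * (Polynomial.X + 1) ^ (PadicInt.toZModPow m (-(Literature.NumberTheory.EllipticCurves.GreenbergVatsal2000.frobeniusExponent 2 (Rat.HeightOneSpectrum.natGenerator v : ℤ_[2])))).val)) %ₘ ((Polynomial.X + 1) ^ 2 ^ m - 1))).supNorm) (n + 2 * k + 2) ≤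
      (fun m : ℕ ↦ ((((Literature.NumberTheory.EllipticCurves.mazurTateElementK g Ω 2 m).map ι * ∏ v ∈ S₀, (1 - Polynomial.C (Literature.NumberTheory.EllipticCurves.embCoeff g ι (Rat.HeightOneSpectrum.natGenerator v)) * Polynomial.X + (if Rat.HeightOneSpectrum.natGenerator v ∣ M then 0 else Polynomial.C (Rat.HeightOneSpectrum.natGenerator v : PadicAlgCl 2)) * Polynomial.X ^ 2).comp (Polynomial.C ((Rat.HeightOneSpectrum.natGenerator v : PadicAlgCl 2)⁻¹) * (Polynomial.X + 1) ^ (PadicInt.toZModPow m (-(Literature.NumberTheory.EllipticCurves.GreenbergVatsal2000.frobeniusExponent 2 (Rat.HeightOneSpectrum.natGenerator v : ℤ_[2])))).val)) %ₘ ((Polynomial.X + 1) ^ 2 ^ m - 1))).supNorm) (n + 2 * k)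
    rw [e1, e2]
    exact h3.le

/-- **Crux `ThetaLayerLambdaCongruenceAtTwo` BY NAME from RELATIVE CONGRUENCE AT INFINITELY MANY EVEN LAYERS** — the sharpest
single research input of the line: (R∞) «for all data of the crux and every `N₀` there is an even `n ≥ N₀` and a scalar `a ∈ ℚ̄₂`
with `‖C a·Θ^{S₀}_n(W) − Θ^{S₀}_n(g;Ω)‖_sup < ‖Θ^{S₀}_n(g;Ω)‖_sup`» (scale-free congruence of the depleted layer elements at
infinitely many even layers — Greenberg–Vatsal (10) / Vatsal (1.10) read at `2`, with NO `μ`-clause and NO "for all large `n`").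
Indeed at such a layer both elements are non-zero and `λ(Θ_n(W)) = λ(Θ_n(g;Ω))` (isosceles + the landed A2), so (IO) holds.
[cite: GreenbergVatsal2000, (10) and Thm. (1.4) (shape; the input is a hypothesis)] -/
theorem thetaLayerLambdaCongruenceAtTwo_of_frequently_relCongruent
    (h1 : ∀ (W : WeierstrassCurve ℚ) [W.IsElliptic] [W.IsGloballyMinimal], ¬ W.HasCM → W.analyticRank = 0 → Literature.NumberTheory.EllipticCurves.Rank1Residual.GoodSS W 2 → W.frobeniusTrace 2 = 0 → W.Δ < 0 → ∀ (M : ℕ) [NeZero M] (g : CuspForm (CongruenceSubgroup.Gamma0 M) 2) (ι : Literature.NumberTheory.EllipticCurves.ModularForms.coeffField g →+* PadicAlgCl 2) (Ω : ℂ), Odd M → Literature.NumberTheory.EllipticCurves.ModularForms.IsNewform0 g → Literature.NumberTheory.Automorphic.IsCMForm (Literature.NumberTheory.EllipticCurves.ModularForms.liftToGamma1 M 2 g) → Literature.NumberTheory.EllipticCurves.ModularForms.cuspCoeff g 2 = 0 → Literature.NumberTheory.EllipticCurves.IsPlusPeriod g Ω → (∀ ℓ : ℕ, ℓ.Prime →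 ¬ ℓ ∣ 2 * M * W.conductorNorm ℤ → ‖Literature.NumberTheory.EllipticCurves.embCoeff g ι ℓ - (W.frobeniusTrace ℓ : PadicAlgCl 2)‖ < 1) → ∀ [NeZero (W.conductorNorm ℤ)] (f : CuspForm (CongruenceSubgroup.Gamma0 (W.conductorNorm ℤ)) 2), Literature.NumberTheory.EllipticCurves.ModularForms.IsNewformOf W f → ∀ (S₀ : Finset (IsDedekindDomain.HeightOneSpectrum (NumberField.RingOfIntegers ℚ))), (∀ v ∈ S₀, ((2 : ℕ) : NumberField.RingOfIntegers ℚ) ∉ v.asIdeal) → (∀ v : IsDedekindDomain.HeightOneSpectrum (NumberField.RingOfIntegers ℚ), ¬ W.HasGoodReductionAt v → v ∈ S₀) → (∀ v : IsDedekindDomain.HeightOneSpectrum (NumberField.RingOfIntegers ℚ), Rat.HeightOneSpectrum.natGenerator v ∣ M → v ∈ S₀) → ∀ N₀ : ℕ, ∃ n : ℕ, N₀ ≤ n ∧ Even n ∧ ∃ a : PadicAlgCl 2, (Polynomial.C a * (((Literature.NumberTheory.EllipticCurves.mazurTateElement f 2 n).map (algebraMap ℚ (PadicAlgCl 2)) *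 ∏ v ∈ S₀, ((W.localPolynomialAt v).map (Int.castRingHom (PadicAlgCl 2))).comp (Polynomial.C ((Rat.HeightOneSpectrum.natGenerator v : PadicAlgCl 2)⁻¹) * (Polynomial.X + 1) ^ (PadicInt.toZModPow n (-(Literature.NumberTheory.EllipticCurves.GreenbergVatsal2000.frobeniusExponent 2 (Rat.HeightOneSpectrum.natGenerator v : ℤ_[2])))).val)) %ₘ ((Polynomial.X + 1) ^ 2 ^ n - 1)) - (((Literature.NumberTheory.EllipticCurves.mazurTateElementK g Ω 2 n).map ι * ∏ v ∈ S₀, (1 - Polynomial.C (Literature.NumberTheory.EllipticCurves.embCoeff g ι (Rat.HeightOneSpectrum.natGenerator v)) * Polynomial.X + (if Rat.HeightOneSpectrum.natGenerator v ∣ M then 0 else Polynomial.C (Rat.HeightOneSpectrum.natGenerator v : PadicAlgCl 2)) * Polynomial.X ^ 2).comp (Polynomial.C ((Rat.HeightOneSpectrum.natGenerator v : PadicAlgCl 2)⁻¹) * (Polynomial.X + 1) ^ (PadicInt.toZModPow n (-(Literature.NumberTheory.EllipticCurves.GreenbergVatsal2000.frobeniusExponent 2 (Rat.HeightOneSpectrum.natGenerator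 v : ℤ_[2])))).val)) %ₘ ((Polynomial.X + 1) ^ 2 ^ n - 1))).supNorm < (((Literature.NumberTheory.EllipticCurves.mazurTateElementK g Ω 2 n).map ι * ∏ v ∈ S₀, (1 - Polynomial.C (Literature.NumberTheory.EllipticCurves.embCoeff g ι (Rat.HeightOneSpectrum.natGenerator v)) * Polynomial.X + (if Rat.HeightOneSpectrum.natGenerator v ∣ M then 0 else Polynomial.C (Rat.HeightOneSpectrum.natGenerator v : PadicAlgCl 2)) * Polynomial.X ^ 2).comp (Polynomial.C ((Rat.HeightOneSpectrum.natGenerator v : PadicAlgCl 2)⁻¹) * (Polynomial.X + 1) ^ (PadicInt.toZModPow n (-(Literature.NumberTheory.EllipticCurves.GreenbergVatsal2000.frobeniusExponent 2 (Rat.HeightOneSpectrum.natGenerator v : ℤ_[2])))).val)) %ₘ ((Polynomial.X + 1) ^ 2 ^ n - 1)).supNorm) :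
    Summit.BirchSwinnertonDyer.BirchSwinnertonDyer.Theses.ResidualThetaTransportAtTwo.ThetaLayerLambdaCongruenceAtTwo := by
  refine thetaLayerLambdaCongruenceAtTwo_of_frequently_eq ?_
  intro W _ _ hcm hr hss ha hΔ M _ g ι Ω hodd hnew hcmg ha2 hΩ hcong _ f hf S₀ hS2 hSW hSM N₀
  obtain ⟨n, hn, he, a, hlt⟩ := h1 W hcm hr hss ha hΔ M g ι Ω hodd hnew hcmg ha2 hΩ hcong f hf S₀ hS2 hSW hSM N₀
  obtain ⟨ha0, hlt'⟩ := ne_zero_and_supNorm_sub_C_inv_mul_lt hlt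
  refine ⟨n, hn, he, ?_, ?_, stub_layerLambda_stable _ _ (a⁻¹) (inv_ne_zero ha0) hlt'⟩
  · intro hz
    rw [hz, supNorm_zero] at hlt'
    exact not_lt.mpr (supNorm_nonneg _) hlt'
  · intro hz
    rw [hz, supNorm_zero] at hlt
    exact not_lt.mpr (supNorm_nonneg _) hlt

end Summit.BirchSwinnertonDyer.BirchSwinnertonDyer.Theorems.ThetaLayerLambdaCongruenceAtTwo

end
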